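import Mathlib
import Summits.MatrixMultiplication.MatrixMultiplication.Theses.GroupTheoreticSTPP
import Literature.Computability.AlgebraicComplexity.PrattTrapezoidValSDPP
import Literature.Computability.AlgebraicComplexity.GroupTheoreticMatMulThmBProofs

/-!
# Two families certify `X_C` (`CPackingConstruction → CThesis`) — stub `stub_packingToCThesis`

Line `two-families-salem-spencer` of crux `ThinBlockAlpha.ThinPackings` (stmt-MatrixMultiplication-10595),
lead a1, 2026-08-16.  Also the missing sufficiency glue of route GroupTheoreticSTPP
(`CPackingConstruction`, stmt-0595 ⟹ `CThesis`, stmt-0593).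

Proof (Cohn–Kleinberg–Szegedy–Umans 2005 §6.2 "triangle-free sets", as recalled in the proof of
Pratt 2024 Thm. 4.7; every ingredient is a PROVED tree theorem): given `ε > 0` put
`δ := min ε 1 / 20`; take `n` large and an SDPP design `(Aᵢ, Bᵢ)_{i<n}` in a finite abelian `H` with
`|H| ≤ n^{2+δ}`, `|Aᵢ||Bᵢ| ≥ n^{2−δ}` (the hypothesis), and a corner-free index configuration
`j₁ j₂ j₃ : ι₀ → Fin n` with `n^{2−δ} ≤ 64·|ι₀|`
(`Literature.Computability.AlgebraicComplexity.exists_cornerFree_indexMaps_card_ge`, Behrend).  The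
CKSU lift `(A (j₁x) × {0} × B (j₃x), B (j₁x) × A (j₂x) × {0}, {0} × B (j₂x) × A (j₃x))_{x ∈ ι₀}` is an
STPP family in `H × H × H` (`addSimultaneousTPP_of_sdpp`), re-indexed by `Fin |ι₀|`
(`AddSimultaneousTPP.comp`) and unfolded to the route's inlined predicate
(`addSimultaneousTPP_iff_forall`); its volumes are `∏ₜ |A (jₜ x)||B (jₜ x)| ≥ n^{3(2−δ)}`
(`card_mul_card_mul_card_sdpp`), so
`Σₓ volₓ^{(2+ε)/3} ≥ |ι₀|·n^{(2−δ)(2+ε)} ≥ n^{(2−δ)(3+ε)}/64 > n^{3(2+δ)} ≥ |H|³`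
because `(2−δ)(3+ε) − 3(2+δ) = 2ε − 6δ − δε ≥ ε` and `n^ε > 64`.
-/

set_option linter.dupNamespace false  -- `Summit.<S>.<S>.…` is the mandated namespace

namespace Summit.MatrixMultiplication.MatrixMultiplication.Theorems.ThinPackings

open Finset
open Summit.MatrixMultiplication.MatrixMultiplication.Theses.GroupTheoreticSTPP (CPackingConstruction CThesis)
open Literature.Computability.AlgebraicComplexity (addSimultaneousTPP_of_sdpp card_mul_card_mul_card_sdpp
  exists_cornerFree_indexMaps_card_ge)
open Literature.Combinatorics.Additive (AddSimultaneousTPP addSimultaneousTPP_iff_forall)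

/-- Eventually `64 < n^ε`: an explicit threshold from `x ↦ x^ε → ∞`. [folklore] -/
theorem exists_nat_rpow_gt (ε : ℝ) (hε : 0 < ε) (K : ℝ) :
    ∃ n₀ : ℕ, ∀ n : ℕ, n₀ ≤ n → K < (n : ℝ) ^ ε := by
  have ht := tendsto_rpow_atTop hε
  obtain ⟨X, hX⟩ := Filter.eventually_atTop.1 (ht.eventually_gt_atTop K)
  refine ⟨⌈X⌉₊, fun n hn => hX n ?_⟩
  exact (Nat.le_ceil X).trans (by exact_mod_cast hn)

/-- Volume of one lifted block: `|Â_x||B̂_x||Ĉ_x| = ∏ₜ |A (jₜ x)||B (jₜ x)| ≥ c³` when every pair has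
`|A i||B i| ≥ c`. [cite: Pratt2024, Thm. 4.7 (proof)] -/
theorem lift_volume_ge {H : Type*} [AddCommGroup H] [DecidableEq H] {n : ℕ} (A B : Fin n → Finset H)
    {ι₀ : Type*} (j₁ j₂ j₃ : ι₀ → Fin n) (x : ι₀) {c : ℝ} (hc0 : 0 ≤ c)
    (hAB : ∀ i : Fin n, c ≤ (((A i).card * (B i).card : ℕ) : ℝ)) :
    c * c * c ≤ (((A (j₁ x) ×ˢ (({0} : Finset H) ×ˢ B (j₃ x))).card *
        (B (j₁ x) ×ˢ (A (j₂ x) ×ˢ ({0} : Finset H))).card *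
        (({0} : Finset H) ×ˢ (B (j₂ x) ×ˢ A (j₃ x))).card : ℕ) : ℝ) := by
  rw [card_mul_card_mul_card_sdpp]
  have h1 := hAB (j₁ x)
  have h2 := hAB (j₂ x)
  have h3 := hAB (j₃ x)
  push_cast at h1 h2 h3 ⊢
  gcongr

/-- **Two families certify `X_C`** (`stub_packingToCThesis` of line `two-families-salem-spencer`,
statement verbatim `CPackingConstruction → CThesis`): CKSU Conjecture 4.7 implies the abelian STPP
`ω = 2` thesis, by the CKSU triangle lift over a Behrend corner-free index set.
[cite: CohnKleinbergSzegedyUmans2005, §6] [cite: Pratt2024, Thm. 4.7 (proof)] [new assembly of tree theorems] -/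
theorem stub_packingToCThesis : CPackingConstruction → CThesis := by
  intro hP ε hε
  classical
  -- parameters
  set δ : ℝ := min ε 1 / 20 with hδ
  have hmin0 : 0 < min ε 1 := lt_min hε one_pos
  have hδ0 : 0 < δ := by rw [hδ]; positivity
  have hδε : δ ≤ ε / 20 := by rw [hδ]; linarith [min_le_left ε 1]
  have hδ1 : δ ≤ 1 / 20 := by rw [hδ]; linarith [min_le_right ε 1]
  have hδle1 : δ ≤ 1 := by linarith
  -- thresholds: corner-free configurations exist from `n₁` on, `64 < n^ε` from `n₂` on
  obtain ⟨n₁, hn₁⟩ := exists_cornerFree_indexMaps_card_ge δ hδ0 hδle1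
  obtain ⟨n₂, hn₂⟩ := exists_nat_rpow_gt ε hε 64
  -- the SDPP design
  obtain ⟨n, hn, H, instG, instF, A, B, hD, hSD, hH, hAB⟩ := hP δ hδ0 (max (max n₁ n₂) 2)
  have hn1 : n₁ ≤ n := le_trans (le_trans (le_max_left _ _) (le_max_left _ _)) hn
  have hn2 : n₂ ≤ n := le_trans (le_trans (le_max_right _ _) (le_max_left _ _)) hn
  have hn2' : 2 ≤ n := le_trans (le_max_right _ _) hn
  have hnR1 : (1 : ℝ) ≤ n := by exact_mod_cast (le_trans (by norm_num) hn2')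
  have hnpos : (0 : ℝ) < n := by linarith
  have h64 : (64 : ℝ) < (n : ℝ) ^ ε := hn₂ n hn2
  -- the corner-free index configuration
  obtain ⟨ι₀, instι, instDec, j₁, j₂, j₃, hcard, hcf⟩ := hn₁ n hn1
  -- the CKSU lift, an STPP family in `H × H × H` indexed by `ι₀`, re-indexed by `Fin |ι₀|`
  have hS : AddSimultaneousTPP (fun x => A (j₁ x) ×ˢ (({0} : Finset H) ×ˢ B (j₃ x)))
      (fun x => B (j₁ x) ×ˢ (A (j₂ x) ×ˢ ({0} : Finset H)))
      (fun x => ({0} : Finset H) ×ˢ (B (j₂ x) ×ˢ A (j₃ x))) :=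
    addSimultaneousTPP_of_sdpp hD hSD j₁ j₂ j₃ hcf
  obtain ⟨e, he⟩ : ∃ e : Fin (Fintype.card ι₀) → ι₀, Function.Injective e :=
    ⟨(Fintype.equivFin ι₀).symm, (Fintype.equivFin ι₀).symm.injective⟩
  have hS' := Literature.Combinatorics.Additive.AddSimultaneousTPP.comp hS he
  rw [addSimultaneousTPP_iff_forall] at hS'
  refine ⟨H × H × H, inferInstance, inferInstance, Fintype.card ι₀, _, _, _, hS', ?_⟩
  -- the count: `|H|³ ≤ n^{3(2+δ)} < |ι₀| · n^{(2-δ)(2+ε)} ≤ Σₓ volₓ^{(2+ε)/3}`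
  have hhost : (Fintype.card (H × H × H) : ℝ) ≤ (n : ℝ) ^ (3 * (2 + δ)) := by
    rw [Fintype.card_prod, Fintype.card_prod]
    push_cast
    have h3 : (n : ℝ) ^ (3 * (2 + δ)) = (n : ℝ) ^ (2 + δ) * (n : ℝ) ^ (2 + δ) * (n : ℝ) ^ (2 + δ) := by
      rw [show (3 * (2 + δ) : ℝ) = (2 + δ) + (2 + δ) + (2 + δ) by ring, Real.rpow_add hnpos,
        Real.rpow_add hnpos]
    rw [h3]
    have hHn : (0 : ℝ) ≤ (Fintype.card H : ℝ) := by positivity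
    calc (Fintype.card H : ℝ) * ((Fintype.card H : ℝ) * (Fintype.card H : ℝ))
        = (Fintype.card H : ℝ) * (Fintype.card H : ℝ) * (Fintype.card H : ℝ) := by ring
      _ ≤ (n : ℝ) ^ (2 + δ) * (n : ℝ) ^ (2 + δ) * (n : ℝ) ^ (2 + δ) := by gcongr
  have hvol0 : (0 : ℝ) ≤ (n : ℝ) ^ (2 - δ) := Real.rpow_nonneg hnpos.le _
  have hvol : ∀ i : Fin (Fintype.card ι₀),
      (n : ℝ) ^ (2 - δ) * (n : ℝ) ^ (2 - δ) * (n : ℝ) ^ (2 - δ) ≤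
        (((A (j₁ (e i)) ×ˢ (({0} : Finset H) ×ˢ B (j₃ (e i)))).card *
          (B (j₁ (e i)) ×ˢ (A (j₂ (e i)) ×ˢ ({0} : Finset H))).card *
          (({0} : Finset H) ×ˢ (B (j₂ (e i)) ×ˢ A (j₃ (e i)))).card : ℕ) : ℝ) :=
    fun i => lift_volume_ge A B j₁ j₂ j₃ (e i) hvol0 hAB
  have hexp0 : (0 : ℝ) < (2 + ε) / 3 := by positivity
  have hn3 : (n : ℝ) ^ ((2 - δ) * (2 + ε)) =
      ((n : ℝ) ^ (2 - δ) * (n : ℝ) ^ (2 - δ) * (n : ℝ) ^ (2 - δ)) ^ ((2 + ε) / 3) := by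
    rw [← Real.rpow_add hnpos, ← Real.rpow_add hnpos, ← Real.rpow_mul hnpos.le]
    ring_nf
  have hterm : ∀ i : Fin (Fintype.card ι₀), (n : ℝ) ^ ((2 - δ) * (2 + ε)) ≤
      (((A (j₁ (e i)) ×ˢ (({0} : Finset H) ×ˢ B (j₃ (e i)))).card *
          (B (j₁ (e i)) ×ˢ (A (j₂ (e i)) ×ˢ ({0} : Finset H))).card *
          (({0} : Finset H) ×ˢ (B (j₂ (e i)) ×ˢ A (j₃ (e i)))).card : ℕ) : ℝ) ^ ((2 + ε) / 3) := by
    intro i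
    rw [hn3]
    exact Real.rpow_le_rpow (by positivity) (hvol i) hexp0.le
  have hsum : ((Fintype.card ι₀ : ℕ) : ℝ) * (n : ℝ) ^ ((2 - δ) * (2 + ε)) ≤
      ∑ i : Fin (Fintype.card ι₀),
        (((A (j₁ (e i)) ×ˢ (({0} : Finset H) ×ˢ B (j₃ (e i)))).card *
          (B (j₁ (e i)) ×ˢ (A (j₂ (e i)) ×ˢ ({0} : Finset H))).card *
          (({0} : Finset H) ×ˢ (B (j₂ (e i)) ×ˢ A (j₃ (e i)))).card : ℕ) : ℝ) ^ ((2 + ε) / 3) := by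
    calc ((Fintype.card ι₀ : ℕ) : ℝ) * (n : ℝ) ^ ((2 - δ) * (2 + ε))
        = ∑ i : Fin (Fintype.card ι₀), (fun _ => (n : ℝ) ^ ((2 - δ) * (2 + ε))) i := by
          rw [sum_const, card_univ, Fintype.card_fin, nsmul_eq_mul]
      _ ≤ _ := sum_le_sum fun i _ => hterm i
  -- numerics: `n^{3(2+δ)} < |ι₀| · n^{(2-δ)(2+ε)}` since `64 |ι₀| ≥ n^{2-δ}` and `n^ε > 64`
  have hkey : (n : ℝ) ^ (3 * (2 + δ)) < ((Fintype.card ι₀ : ℕ) : ℝ) * (n : ℝ) ^ ((2 - δ) * (2 + ε)) := by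
    have hgap : 3 * (2 + δ) + ε ≤ (2 - δ) + (2 - δ) * (2 + ε) := by nlinarith
    have hA : (n : ℝ) ^ ε * (n : ℝ) ^ (3 * (2 + δ)) ≤
        (n : ℝ) ^ (2 - δ) * (n : ℝ) ^ ((2 - δ) * (2 + ε)) := by
      rw [← Real.rpow_add hnpos, ← Real.rpow_add hnpos]
      exact Real.rpow_le_rpow_of_exponent_le hnR1 (by linarith)
    have hpos3 : (0 : ℝ) < (n : ℝ) ^ (3 * (2 + δ)) := Real.rpow_pos_of_pos hnpos _
    have hposE : (0 : ℝ) ≤ (n : ℝ) ^ ((2 - δ) * (2 + ε)) := Real.rpow_nonneg hnpos.le _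
    have h1 : 64 * (n : ℝ) ^ (3 * (2 + δ)) < (n : ℝ) ^ ε * (n : ℝ) ^ (3 * (2 + δ)) :=
      mul_lt_mul_of_pos_right h64 hpos3
    have h2 : (n : ℝ) ^ (2 - δ) * (n : ℝ) ^ ((2 - δ) * (2 + ε)) ≤
        64 * ((Fintype.card ι₀ : ℕ) : ℝ) * (n : ℝ) ^ ((2 - δ) * (2 + ε)) :=
      mul_le_mul_of_nonneg_right hcard hposE
    nlinarith
  have hfin : (Fintype.card (H × H × H) : ℝ) <
      ∑ i : Fin (Fintype.card ι₀),
        (((A (j₁ (e i)) ×ˢ (({0} : Finset H) ×ˢ B (j₃ (e i)))).card *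
          (B (j₁ (e i)) ×ˢ (A (j₂ (e i)) ×ˢ ({0} : Finset H))).card *
          (({0} : Finset H) ×ˢ (B (j₂ (e i)) ×ˢ A (j₃ (e i)))).card : ℕ) : ℝ) ^ ((2 + ε) / 3) :=
    lt_of_lt_of_le (hhost.trans_lt hkey) hsum
  simpa only [Function.comp_apply] using hfin

end Summit.MatrixMultiplication.MatrixMultiplication.Theorems.ThinPackings
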